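import Literature.NumberTheory.LFunctions.JensenPolyaProofs
import Literature.Analysis.Complex.JensenPolynomialCircleKernelRows
import Literature.Analysis.Complex.JensenCircles
import Literature.Analysis.Complex.FourierPolyaKiKimEngine
import Mathlib.Analysis.Analytic.Order
import HarnessLib

/-!
# Rows of the Jensen grid of `ξ`: row `n` hyperbolic in every degree ⟺ `ξ₁⁽ⁿ⁾` has only real
# zeros; the hyperbolic rows form an up-set; RH ⟺ row `0`

Labels (line 1, cell rh-jensen discipline): every theorem here is RH-FREE kernel mathematics about
the Taylor data `γ = xiTaylorCoeff` of `ξ` and the entire function `ξ₁ = xiSq`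
(`ξ(s) = ξ₁((s-½)²)`, `riemannXi_eq_xiSq`), EXCEPT `riemannHypothesis_iff_xiRowHyperbolic_zero`,
which is an RH-EQUIVALENT restatement (the row `n = 0` of the Jensen–Pólya criterion
`Literature.NumberTheory.LFunctions.polya_jensen`). Nothing in this file bears on the truth of RH;
typing which row would prove what about `ζ` fixes a dictionary, it does not move RH.

Dictionary. `J^{d,n}_γ = jensenPoly xiTaylorCoeff d n` ([GORZPNAS2019, §1]). ROW `n` of the Jensen
grid `(d, n)` is the shift-`0` row of the Taylor sequence of `8·ξ₁⁽ⁿ⁾`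
(`hasSum_xiTaylorCoeff_shift`: `8 ξ₁⁽ⁿ⁾(w) = Σⱼ γ(n+j) wʲ/j!`, [Farmer2022, §2 eq. (2.2)]:
"`J^{d,n}` is the `d`th Jensen polynomial of the `n`th derivative"), and every `ξ₁⁽ⁿ⁾` is entire of
order `< 1` (`isEntireOfOrderLtOne_iteratedDeriv_xiSq`), real on `ℝ`, with `ξ₁⁽ⁿ⁾(0) = γ(n)/8 > 0`.
Hence, by both halves of Pólya–Schur / Craven–Csordas for order `< 1` (tree:
`im_eq_zero_of_forall_splits_jensenPoly`, `splits_jensenPoly_taylor_of_zeros_real`):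

* `xiRowHyperbolic_iff_xiDerivZerosReal` — `(∀ d, J^{d,n}_γ hyperbolic) ⟺ ξ₁⁽ⁿ⁾` has only real
  zeros [CravenCsordas1989, §1 (i)];
* `xiRowHyperbolic_mono` — the hyperbolic rows form an UP-SET `{n | n⋆ ≤ n}` (Jensen's theorem on
  the zeros of the derivative of a real entire function of order `< 2`, tree
  `abs_im_le_of_iteratedDeriv_eq_zero` with strip width `0`) [KiKim2000, §2 p. 50];
* `riemannHypothesis_iff_xiRowHyperbolic_zero` — RH ⟺ row `0` (RH-EQUIVALENT; [CravenCsordas1989,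
  §1 (i)], [GORZPNAS2019, Thm. 1 discussion]); `xiRowHyperbolic_of_riemannHypothesis` — RH ⇒ every
  row [GORZPNAS2019, §1].

What is NOT here: the cell's own consequences (row `n` hyperbolic in every degree ⇒ every zero of
`ξ` off the critical line has multiplicity `≤ n`; realification-window and band/detection glue) are
new results and live Summits-side in
`Summits/RiemannHypothesis/RiemannHypothesis/Theorems/JensenPolynomialsXiRowMultiplicity.lean`; the
law-grade numbers of the cell memo NEGATION-LENS-R4.md are not formalised anywhere.

Provenance: cell rh-jensen (D-0074 GROUP I, negation lens round 4, `NegationLensR4Sketch.lean`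
§§1–3 of planner-rh-jensen-idea-2-g4-0, 2026-08-26), landed by prover-rh-jensen-eng-2-g4-0 (idea-2
g4 WANTED W3). AI-produced formalisation; AI review is weaker than expert review. Design: the growth
of the derivatives is taken from `Literature.Analysis.Complex.KiKim.exists_growth_iteratedDeriv_of_lt_one`,
the shift identity and the shifted majorant from `Literature.Analysis.Complex.JensenCircleKernel`;
no generic growth lemma is restated here.

## References
* [CravenCsordas1989] T. Craven, G. Csordas, Pacific J. Math. 136 (1989) 241–260, §1 (i), Lemma 2.2.
* [GORZPNAS2019] M. Griffin, K. Ono, L. Rolen, D. Zagier, PNAS 116 (2019) 11103–11110, §1, eq. (1),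
  Thm. 1.
* [Farmer2022] D. W. Farmer, Adv. Math. 411 (2022), §2, eq. (2.2).
* [KiKim2000] H. Ki, Y.-O. Kim, Duke Math. J. 104 (2000), §2 p. 50 (Jensen's theorem), Lemma 2.1.
* [Titchmarsh1986] E. C. Titchmarsh, The theory of the Riemann zeta-function, 2nd ed., §2.12.
-/

open Polynomial Complex Filter Topology Set
open scoped ComplexConjugate Nat

namespace Literature.NumberTheory.LFunctions

open Literature.Analysis.Complex Literature.Analysis.Complex.PolyaSchur
  Literature.Analysis.TotalPositivity

/-! ## Row `n` = shift `0` of `8·ξ₁⁽ⁿ⁾` -/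

/-- `ξ₁⁽ᵏ⁾(0) = γ(k)/8` as a real number cast to `ℂ` — the Taylor coefficients of
`ξ(½ + z) = Σ γ(n) z^{2n}/(2n)!`-type data in the tree normalisation (repackaging of the tree's
`xiTaylorCoeff_eq_re_iteratedDeriv_xiSq` and `im_iteratedDeriv_xiSq`; cf. `iteratedDeriv_xiSq_zero`).
[cite: GORZPNAS2019, §1 eq. (1)] -/
theorem iteratedDeriv_xiSq_zero_eq_ofReal (k : ℕ) :
    iteratedDeriv k xiSq 0 = ((xiTaylorCoeff k / 8 : ℝ) : ℂ) := by
  apply Complex.ext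
  · rw [Complex.ofReal_re, xiTaylorCoeff_eq_re_iteratedDeriv_xiSq]; ring
  · rw [Complex.ofReal_im, im_iteratedDeriv_xiSq]

/-- `f⁽ⁿ⁺ᵏ⁾ = (f⁽ⁿ⁾)⁽ᵏ⁾` (= `Literature.Barriers.RiemannHypothesis.iteratedDeriv_add_eq` of
`JensenPolynomialsKimCorollary`, restated privately to keep the imports light). [folklore] -/
private theorem iteratedDeriv_add_eq_iteratedDeriv (f : ℂ → ℂ) (n k : ℕ) :
    iteratedDeriv (n + k) f = iteratedDeriv k (iteratedDeriv n f) := by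
  rw [iteratedDeriv_eq_iterate, iteratedDeriv_eq_iterate, iteratedDeriv_eq_iterate, add_comm,
    Function.iterate_add_apply]

/-- **Row `n` is the Taylor sequence of `8 ξ₁⁽ⁿ⁾`:** `8 ξ₁⁽ⁿ⁾(w) = Σⱼ γ(n+j) wʲ/j!` for every `w`
("`J^{d,n}` is the `d`th classical Jensen polynomial of the `n`th derivative").
[cite: Farmer2022, §2 eq. (2.2)] -/
theorem hasSum_xiTaylorCoeff_shift (n : ℕ) (w : ℂ) :
    HasSum (fun j : ℕ => (xiTaylorCoeff (n + j) : ℂ) / (j ! : ℂ) * w ^ j)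
      (8 * iteratedDeriv n xiSq w) := by
  have hd : Differentiable ℂ (iteratedDeriv n xiSq) :=
    differentiable_iteratedDeriv_of_entire differentiable_xiSq n
  have h := (Complex.hasSum_taylorSeries_of_entire hd 0 w).mul_left 8
  have key : (fun j : ℕ => (xiTaylorCoeff (n + j) : ℂ) / (j ! : ℂ) * w ^ j) =
      fun j : ℕ => 8 * ((j ! : ℂ)⁻¹ • (w - 0) ^ j • iteratedDeriv j (iteratedDeriv n xiSq) 0) := by
    funext j
    rw [← iteratedDeriv_add_eq_iteratedDeriv xiSq n j, iteratedDeriv_xiSq_zero_eq_ofReal, sub_zero,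
      smul_eq_mul, smul_eq_mul]
    have hj : (j ! : ℂ) ≠ 0 := by exact_mod_cast Nat.factorial_ne_zero j
    push_cast
    field_simp
  rw [key]
  exact h

/-- `8 ξ₁⁽ⁿ⁾(0) = γ(n) ≠ 0` (indeed `γ(n) > 0`, tree `xiTaylorCoeff_pos_holds`).
[cite: GORZPNAS2019, §1 (γ(n) > 0)] -/
theorem eight_mul_iteratedDeriv_xiSq_zero_ne (n : ℕ) : (8 : ℂ) * iteratedDeriv n xiSq 0 ≠ 0 := by
  rw [iteratedDeriv_xiSq_zero_eq_ofReal, ← Complex.ofReal_ofNat, ← Complex.ofReal_mul,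
    Complex.ofReal_ne_zero]
  have := xiTaylorCoeff_pos_holds n
  positivity

/-- No derivative of `ξ₁` vanishes identically (its value at `0` is `γ(k)/8 > 0`). [folklore] -/
private theorem iteratedDeriv_xiSq_ne_zero (k : ℕ) : iteratedDeriv k xiSq ≠ 0 := by
  intro h
  have := eight_mul_iteratedDeriv_xiSq_zero_ne k
  rw [h] at this
  simp at this

/-- `ξ₁` is real on the real axis (from `xiSq_conj`). [folklore] -/
private theorem im_xiSq_ofReal (x : ℝ) : (xiSq x).im = 0 := by
  have h := xiSq_conj x
  rw [Complex.conj_ofReal] at h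
  exact Complex.conj_eq_iff_im.1 h.symm

/-- Every derivative `ξ₁⁽ⁿ⁾` satisfies `‖ξ₁⁽ⁿ⁾(z)‖ ≤ C' exp(‖z‖^{7/8})`: the exponent `7/8` of the
tree's `norm_xiSq_le` (`ξ₁ = Ξ(√·)` is of order `½`) is inherited by all derivatives through
Cauchy's estimate on unit circles (tree `KiKim.exists_growth_iteratedDeriv_of_lt_one`).
[cite: Titchmarsh1986, §2.12 (Ξ(√z) is an integral function of order ½)]
[cite: KiKim2000, §2 Lemma 2.1 (Cauchy's estimate under the growth bound)] -/
theorem exists_growth_iteratedDeriv_xiSq (n : ℕ) :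
    ∃ C' : ℝ, 0 ≤ C' ∧ ∀ z : ℂ, ‖iteratedDeriv n xiSq z‖ ≤ C' * Real.exp (‖z‖ ^ (7 / 8 : ℝ)) := by
  obtain ⟨C, hC⟩ := norm_xiSq_le
  exact KiKim.exists_growth_iteratedDeriv_of_lt_one differentiable_xiSq (by norm_num) (by norm_num)
    (growthConst_nonneg hC) hC n

/-- Every derivative of `ξ₁` is entire of order `< 1` (exponent `7/8`), in the tree's quantitative
sense `IsEntireOfOrderLtOne`. [cite: Titchmarsh1986, §2.12 (Ξ(√z) is an integral function of order ½)]
[cite: KiKim2000, §2 Lemma 2.1] -/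
theorem isEntireOfOrderLtOne_iteratedDeriv_xiSq (n : ℕ) :
    IsEntireOfOrderLtOne (iteratedDeriv n xiSq) := by
  obtain ⟨C', -, hC'⟩ := exists_growth_iteratedDeriv_xiSq n
  exact ⟨differentiable_iteratedDeriv_of_entire differentiable_xiSq n, 7 / 8, C', by norm_num, hC'⟩

/-! ## Row `n` ⟺ `ξ₁⁽ⁿ⁾` has only real zeros; the hyperbolic rows form an up-set -/

/-- Row `n` of the Jensen grid of `ξ` is hyperbolic in every degree: all `J^{d,n}_γ`, `d ∈ ℕ`,
have only real roots. [cite: GORZPNAS2019, §1] -/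
def XiRowHyperbolic (n : ℕ) : Prop := ∀ d : ℕ, (jensenPoly xiTaylorCoeff d n).Splits

/-- `Z_n = ∅`: the `n`-th derivative of `ξ₁` has only real zeros (`ξ₁⁽ⁿ⁾ ∈ 𝓛–𝓟`).
[cite: CravenCsordas1989, §1 (i)] -/
def XiDerivZerosReal (n : ℕ) : Prop := ∀ w : ℂ, iteratedDeriv n xiSq w = 0 → w.im = 0

/-- **Row `n` hyperbolic in every degree ⇒ `ξ₁⁽ⁿ⁾` has only real zeros** (Pólya–Schur / Hurwitz
half, tree `im_eq_zero_of_forall_splits_jensenPoly`, applied to `8 ξ₁⁽ⁿ⁾` through the shift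
identity `JensenCircleKernel.jensenPoly_shift`). [cite: CravenCsordas1989, §1 (i)] -/
theorem xiDerivZerosReal_of_xiRowHyperbolic {n : ℕ} (h : XiRowHyperbolic n) :
    XiDerivZerosReal n := by
  intro w hw
  refine im_eq_zero_of_forall_splits_jensenPoly (γ := fun j => xiTaylorCoeff (n + j))
    (F := fun w => 8 * iteratedDeriv n xiSq w)
    (JensenCircleKernel.summable_shift_majorant summable_abs_xiTaylorCoeff_div_factorial_mul_pow n)
    (hasSum_xiTaylorCoeff_shift n)
    ((differentiable_iteratedDeriv_of_entire differentiable_xiSq n).const_mul 8)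
    (eight_mul_iteratedDeriv_xiSq_zero_ne n) (fun d => ?_) (by simp [hw])
  rw [← JensenCircleKernel.jensenPoly_shift]
  exact h d

/-- **`ξ₁⁽ⁿ⁾` has only real zeros ⇒ row `n` hyperbolic in every degree** (Hadamard +
Hermite–Poulain half for order `< 1`, tree `splits_jensenPoly_taylor_of_zeros_real` applied to
`ξ₁⁽ⁿ⁾`). [cite: CravenCsordas1989, §1 (i)] -/
theorem xiRowHyperbolic_of_xiDerivZerosReal {n : ℕ} (h : XiDerivZerosReal n) :
    XiRowHyperbolic n := by
  intro d
  have h0 : iteratedDeriv n xiSq 0 ≠ 0 := fun h' =>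
    eight_mul_iteratedDeriv_xiSq_zero_ne n (by rw [h', mul_zero])
  have hs := splits_jensenPoly_taylor_of_zeros_real (isEntireOfOrderLtOne_iteratedDeriv_xiSq n)
    (im_iteratedDeriv_xiSq n) h0 h d 0
  have heq : jensenPoly xiTaylorCoeff d n =
      C 8 * jensenPoly (fun k => (iteratedDeriv k (iteratedDeriv n xiSq) 0).re) d 0 := by
    rw [JensenCircleKernel.jensenPoly_shift, ← jensenPoly_const_mul]
    congr 1
    funext k
    rw [← iteratedDeriv_add_eq_iteratedDeriv, iteratedDeriv_xiSq_zero_eq_ofReal, Complex.ofReal_re]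
    ring
  rw [heq]
  exact hs.C_mul 8

/-- **Row dictionary:** `(∀ d, J^{d,n}_γ hyperbolic) ⟺ ξ₁⁽ⁿ⁾` has only real zeros.
[cite: CravenCsordas1989, §1 (i)] -/
theorem xiRowHyperbolic_iff_xiDerivZerosReal (n : ℕ) : XiRowHyperbolic n ↔ XiDerivZerosReal n :=
  ⟨xiDerivZerosReal_of_xiRowHyperbolic, xiRowHyperbolic_of_xiDerivZerosReal⟩

/-- **`Z_n = ∅ ⇒ Z_m = ∅` for `m ≥ n`** (Jensen's theorem: a non-real zero of `f'` lies in the Jensen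
disc of a non-real zero of `f`, for `f` real entire of order `< 2`; tree
`abs_im_le_of_iteratedDeriv_eq_zero` with strip width `Δ = 0`, applied to `f = ξ₁⁽ⁿ⁾`).
[cite: KiKim2000, §2 p. 50 (Jensen's theorem)] -/
theorem xiDerivZerosReal_mono {n m : ℕ} (hnm : n ≤ m) (h : XiDerivZerosReal n) :
    XiDerivZerosReal m := by
  obtain ⟨k, rfl⟩ := Nat.exists_eq_add_of_le hnm
  intro w hw
  obtain ⟨C, -, hgr⟩ := exists_growth_iteratedDeriv_xiSq n
  have hf := differentiable_iteratedDeriv_of_entire differentiable_xiSq n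
  have hreal : ∀ x : ℝ, (iteratedDeriv n xiSq x).im = 0 :=
    im_iteratedDeriv_ofReal differentiable_xiSq im_xiSq_ofReal n
  have hnz : ∀ j : ℕ, iteratedDeriv j (iteratedDeriv n xiSq) ≠ 0 := fun j => by
    rw [← iteratedDeriv_add_eq_iteratedDeriv]
    exact iteratedDeriv_xiSq_ne_zero (n + j)
  have hstrip : ∀ z, iteratedDeriv n xiSq z = 0 → |z.im| ≤ 0 := fun z hz => by
    rw [h z hz, abs_zero]
  have hw' : iteratedDeriv k (iteratedDeriv n xiSq) w = 0 := by
    rw [← iteratedDeriv_add_eq_iteratedDeriv]; exact hw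
  have := abs_im_le_of_iteratedDeriv_eq_zero hf (ρ := 7 / 8) (by norm_num) (by norm_num) hgr hreal
    hnz le_rfl hstrip k hw'
  exact abs_nonpos_iff.1 this

/-- **The hyperbolic rows form an up-set:** row `n` hyperbolic in every degree ⇒ row `m`
hyperbolic in every degree for all `m ≥ n`. [cite: KiKim2000, §2 p. 50 (Jensen's theorem)]
[cite: CravenCsordas1989, §1 (i)] -/
theorem xiRowHyperbolic_mono {n m : ℕ} (hnm : n ≤ m) (h : XiRowHyperbolic n) : XiRowHyperbolic m :=
  xiRowHyperbolic_of_xiDerivZerosReal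
    (xiDerivZerosReal_mono hnm (xiDerivZerosReal_of_xiRowHyperbolic h))

/-- **RH ⟺ row `0` hyperbolic in every degree** — RH-EQUIVALENT (the shift-`0` row of the
Jensen–Pólya criterion; tree `jensenPolyaCriterion_of_riemannHypothesis` and
`riemannHypothesis_of_forall_xiSq_eq_zero_im_eq_zero`; a restatement, not progress toward RH).
[cite: CravenCsordas1989, §1 (i) (Pólya–Schur)] [cite: GORZPNAS2019, Theorem 1 (discussion)] -/
theorem riemannHypothesis_iff_xiRowHyperbolic_zero : RiemannHypothesis ↔ XiRowHyperbolic 0 :=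
  ⟨fun h d => jensenPolyaCriterion_of_riemannHypothesis h d 0,
   fun h => riemannHypothesis_of_forall_xiSq_eq_zero_im_eq_zero fun z hz =>
     xiDerivZerosReal_of_xiRowHyperbolic h z (by simpa using hz)⟩

/-- `RH ⇒` every row is hyperbolic in every degree (the easy half, row-wise).
[cite: GORZPNAS2019, §1] -/
theorem xiRowHyperbolic_of_riemannHypothesis (h : RiemannHypothesis) (n : ℕ) : XiRowHyperbolic n :=
  xiRowHyperbolic_mono (Nat.zero_le n) (riemannHypothesis_iff_xiRowHyperbolic_zero.1 h)

end Literature.NumberTheory.LFunctions
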